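import Mathlib
import Literature.Combinatorics.Additive.NeumannTPPSubgroupIndex
import Literature.Barriers.MatrixMultiplication.QuasirandomBarrierSTPP
import Literature.Computability.AlgebraicComplexity.CohnUmansTPP

/-!
# Family-level obstructions for the TPP/STPP certificate lanes: abelian subgroups of small index,
# and perfect hosts with a large minimal degree

Support file for route `MatrixMultiplication/GroupTheoreticSTPP`, crux `stmt-MatrixMultiplication-0597`
(`CNonabelianTPPFamilies`), cell `mm-stpp` (D-0046).  Companion of
`GroupTheoreticSTPPCNonabelianTPPFamiliesCriterion.lean`, whose rows certify `ω ≤ w` from an inequality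
`d^{w−2}|G| < V^{w/3}` (one TPP triple of volume `V = |S||T||U|`, all character degrees `≤ d`) or
`d^{w−2}|H| < Σᵢ Vᵢ^{w/3}` (an STPP family).  Here we record what such a certificate FORCES on the host
group, i.e. which families of groups can never produce one — negative ranges for the census, proved
from tree theorems only:

* **Abelian subgroup of index `v` (single-TPP lane).**  Neumann 2011, Cor. 4.2 (tree
  `Neumann2011_cor42'`): every TPP triple of a finite group with an abelian subgroup `K` of index `v`
  has `V ≤ v²|G|`.  Hence (`card_rpow_lt_index_rpow_of_tpp_certificate`) a certificate
  `d^{w−2}|G| < V^{w/3}` with ANY `d ≥ 1`, `w ≥ 2` forces `|G|^{3−w} < v^{2w}`, and in the index row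
  (`d = v`, `card_rpow_lt_index_rpow_of_tpp_index_certificate`) `|G|^{3−w} < v^{6−w}`.  Numerically: a
  single TPP triple in an abelian-by-(index `v`) host certifies `ω ≤ 2.3713` only if `v > |G|^{0.1325}`
  (index row: `v > |G|^{0.1732}`), `ω ≤ 2.40` only if `v > |G|^{1/8}` (resp. `|G|^{1/6}`).  For the
  `ω = 2` regime (`card_rpow_le_index_rpow_of_packing_exponent`): `|G| ≤ V^{(2+ε)/3}` forces
  `|G|^{1−ε} ≤ v^{4+2ε}` for EVERY abelian subgroup, i.e. all abelian subgroups of the hosts of an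
  `ω = 2` TPP family have index `≥ |G|^{1/4−O(ε)}`.
* **Perfect hosts (STPP lane, any number of triples).**  Blasiak–Cohn–Grochow–Pratt–Umans 2023,
  Cor. 3.3 in its STPP form (tree `BCGPU2023_thm32_stpp.sum_rpow_two_thirds_le`) bounds
  `Σᵢ Vᵢ^{2/3}` by `M(G) = max(√2|G|^{3/4}, 4^{1/3}|G|/n(G)^{1/3})` (`n(G)` the least degree `> 1`); with
  `Vᵢ ≤ |G|^{3/2}` this gives `Σᵢ Vᵢ^{w/3} ≤ |G|^{(w−2)/2} M(G)` for every `w ≥ 2`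
  (`sum_rpow_le_of_perfect`), so a `d`-row certificate forces `d^{w−2}|G| < |G|^{(w−2)/2} M(G)`
  (`perfect_host_certificate_bound`).  Example (numbers outside Lean): for the Suzuki groups `Sz(q)`
  (`|G| = q²(q²+1)(q−1) ≈ q⁵`, `n(G) = (q−1)√(q/2)`, `d_max = (q+√(2q)+1)(q−1) ≈ q²`) the `d_max` row can
  certify nothing below `3 − O(1/log q)`; at `q = 8` (`|G| = 29120`, `n(G) = 14`, `d_max = 91`) nothing
  below `2.66`.

WHAT THIS IS NOT: no statement about `ω`; these are necessary conditions on HOSTS for the certificate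
rows of the cell's census (instrument / negative ranges).  The single-TPP obstruction says nothing about
STPP families with `≥ 2` triples in the same hosts (there only the per-triple bound `Vᵢ ≤ v²|G|` and
packing survive, and the STPP lane in abelian-by-cyclic hosts is as open as the abelian one).

## References
* P. M. Neumann, LMS J. Comput. Math. 14 (2011), Obs. 4.1, Cor. 4.2.
* J. Blasiak, H. Cohn, J. A. Grochow, K. Pratt, C. Umans, ITCS 2023, arXiv:2204.03826, Thm. 3.2,
  Cor. 3.3.
* H. Cohn, R. Kleinberg, B. Szegedy, C. Umans, FOCS 2005, Cor. 1.9, Thm. 5.5.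
-/

-- single-conjunct summit: the mandated namespace repeats `MatrixMultiplication`.
set_option linter.dupNamespace false

noncomputable section

namespace Summit.MatrixMultiplication.MatrixMultiplication.Theorems

namespace TPPLaneObstruction

open Finset Literature.Computability.AlgebraicComplexity Literature.Combinatorics.Additive
  Literature.RepresentationTheory.FiniteGroups Literature.Barriers.MatrixMultiplication

/-! ### Hosts with an abelian subgroup of index `v`: the single-TPP lane -/

section AbelianIndex

variable {G : Type} [Group G] [Fintype G]

/-- Neumann's bound in real form: a TPP triple of a finite group with an abelian subgroup `K` has
`|S||T||U| ≤ [G:K]² · |G|`. [cite: Neumann2011, Cor. 4.2] -/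
theorem tpp_volume_le_index_sq_mul_card (K : Subgroup G) [IsMulCommutative K] {S T U : Finset G}
    (h : TripleProductProperty S T U) :
    (((S.card * T.card * U.card : ℕ)) : ℝ) ≤ (K.index : ℝ) ^ (2 : ℝ) * Fintype.card G := by
  classical
  rw [Real.rpow_two]
  exact_mod_cast Neumann2011_cor42' K h

/-- **Single-TPP certificates need a large abelian index.**  If `G` has an abelian subgroup `K` of
index `v` and a TPP triple `S, T, U` of volume `V = |S||T||U|` satisfies the certificate inequality
`d^{w−2}|G| < V^{w/3}` of the `d`-row (`STPPCriterion.omega_le_of_tpp_maxCharDegree`) for some `d ≥ 1`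
and `w ≥ 2`, then `|G|^{3−w} < v^{2w}` — because `V ≤ v²|G|` (Neumann 2011, Cor. 4.2), so
`|G| ≤ d^{w−2}|G| < (v²|G|)^{w/3}`.  (So `w = 2.3713` needs `v > |G|^{0.1325}`, `w = 2.4` needs
`v > |G|^{1/8}`.) [cite: Neumann2011, Cor. 4.2] -/
theorem card_rpow_lt_index_rpow_of_tpp_certificate (K : Subgroup G) [IsMulCommutative K]
    {S T U : Finset G} (h : TripleProductProperty S T U) {d : ℕ} (hd1 : 1 ≤ d) {w : ℝ} (hw2 : 2 ≤ w)
    (hcert : (d : ℝ) ^ (w - 2) * Fintype.card G < ((S.card * T.card * U.card : ℕ) : ℝ) ^ (w / 3)) :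
    (Fintype.card G : ℝ) ^ (3 - w) < (K.index : ℝ) ^ (2 * w) := by
  haveI : K.FiniteIndex := Subgroup.finiteIndex_of_finite
  have hVle := tpp_volume_le_index_sq_mul_card K h
  have hGpos : (0 : ℝ) < Fintype.card G := by exact_mod_cast Fintype.card_pos
  have hvpos : (0 : ℝ) < K.index := by
    exact_mod_cast Nat.pos_of_ne_zero Subgroup.FiniteIndex.index_ne_zero
  -- `|G| ≤ d^{w-2}|G| < V^{w/3} ≤ (v²|G|)^{w/3} = v^{2w/3} |G|^{w/3}`
  have h1 : (Fintype.card G : ℝ) ≤ (d : ℝ) ^ (w - 2) * Fintype.card G :=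
    le_mul_of_one_le_left hGpos.le (Real.one_le_rpow (by exact_mod_cast hd1) (by linarith))
  have h2 : (((S.card * T.card * U.card : ℕ)) : ℝ) ^ (w / 3) ≤
      ((K.index : ℝ) ^ (2 : ℝ) * Fintype.card G) ^ (w / 3) :=
    Real.rpow_le_rpow (by positivity) hVle (by linarith)
  have h3 : ((K.index : ℝ) ^ (2 : ℝ) * Fintype.card G) ^ (w / 3) =
      (K.index : ℝ) ^ (2 * (w / 3)) * (Fintype.card G : ℝ) ^ (w / 3) := by
    rw [Real.mul_rpow (by positivity) hGpos.le, ← Real.rpow_mul hvpos.le]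
  have hlt : (Fintype.card G : ℝ) <
      (K.index : ℝ) ^ (2 * (w / 3)) * (Fintype.card G : ℝ) ^ (w / 3) := by
    calc (Fintype.card G : ℝ) ≤ (d : ℝ) ^ (w - 2) * Fintype.card G := h1
      _ < (((S.card * T.card * U.card : ℕ)) : ℝ) ^ (w / 3) := hcert
      _ ≤ _ := h2
      _ = _ := h3
  -- logarithms
  have hlog := Real.log_lt_log hGpos hlt
  rw [Real.log_mul (Real.rpow_pos_of_pos hvpos _).ne' (Real.rpow_pos_of_pos hGpos _).ne',
    Real.log_rpow hvpos, Real.log_rpow hGpos] at hlog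
  rw [Real.rpow_def_of_pos hGpos, Real.rpow_def_of_pos hvpos, Real.exp_lt_exp]
  nlinarith [hlog]

/-- **The index row needs an even larger index.**  In the row that USES the abelian subgroup as the
degree bound (`d = v = [G:K]`: `STPPCriterion.omega_le_of_stpp_abelianSubgroup`, or the census row
`OmegaCensus.omega_le_div_of_simultaneousTPP_abelianSubgroup`, with one triple), a certificate
`v^{w−2}|G| < V^{w/3}` with `w ≥ 2` forces `|G|^{3−w} < v^{6−w}` (so `w = 2.3713` needs
`v > |G|^{0.1732}`, `w = 2.4` needs `v > |G|^{1/6}`, `w = 3 − δ` needs `v > |G|^{δ/(3+δ)}`).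
[cite: Neumann2011, Cor. 4.2] -/
theorem card_rpow_lt_index_rpow_of_tpp_index_certificate (K : Subgroup G) [IsMulCommutative K]
    {S T U : Finset G} (h : TripleProductProperty S T U) {w : ℝ} (hw2 : 2 ≤ w)
    (hcert : (K.index : ℝ) ^ (w - 2) * Fintype.card G <
      ((S.card * T.card * U.card : ℕ) : ℝ) ^ (w / 3)) :
    (Fintype.card G : ℝ) ^ (3 - w) < (K.index : ℝ) ^ (6 - w) := by
  haveI : K.FiniteIndex := Subgroup.finiteIndex_of_finite
  have hVle := tpp_volume_le_index_sq_mul_card K h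
  have hGpos : (0 : ℝ) < Fintype.card G := by exact_mod_cast Fintype.card_pos
  have hvpos : (0 : ℝ) < K.index := by
    exact_mod_cast Nat.pos_of_ne_zero Subgroup.FiniteIndex.index_ne_zero
  have h2 : (((S.card * T.card * U.card : ℕ)) : ℝ) ^ (w / 3) ≤
      ((K.index : ℝ) ^ (2 : ℝ) * Fintype.card G) ^ (w / 3) :=
    Real.rpow_le_rpow (by positivity) hVle (by linarith)
  have h3 : ((K.index : ℝ) ^ (2 : ℝ) * Fintype.card G) ^ (w / 3) =
      (K.index : ℝ) ^ (2 * (w / 3)) * (Fintype.card G : ℝ) ^ (w / 3) := by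
    rw [Real.mul_rpow (by positivity) hGpos.le, ← Real.rpow_mul hvpos.le]
  have hlt : (K.index : ℝ) ^ (w - 2) * Fintype.card G <
      (K.index : ℝ) ^ (2 * (w / 3)) * (Fintype.card G : ℝ) ^ (w / 3) := by
    calc (K.index : ℝ) ^ (w - 2) * Fintype.card G
        < (((S.card * T.card * U.card : ℕ)) : ℝ) ^ (w / 3) := hcert
      _ ≤ _ := h2
      _ = _ := h3
  have hlog := Real.log_lt_log (by positivity) hlt
  rw [Real.log_mul (Real.rpow_pos_of_pos hvpos _).ne' hGpos.ne',
    Real.log_mul (Real.rpow_pos_of_pos hvpos _).ne' (Real.rpow_pos_of_pos hGpos _).ne',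
    Real.log_rpow hvpos, Real.log_rpow hvpos, Real.log_rpow hGpos] at hlog
  rw [Real.rpow_def_of_pos hGpos, Real.rpow_def_of_pos hvpos, Real.exp_lt_exp]
  nlinarith [hlog]

/-- **`ω = 2` TPP families need abelian subgroups of index `≥ |G|^{1/4−O(ε)}`.**  If a TPP triple of
volume `V` in `G` meets the packing requirement `|G| ≤ V^{(2+ε)/3}` of the crux `CNonabelianTPPFamilies`
(`ε ≥ 0`), then every abelian subgroup `K` satisfies `|G|^{1−ε} ≤ [G:K]^{4+2ε}` (from `V ≤ [G:K]²|G|`).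
This is the unconditional half of the refuter's note on stmt-MatrixMultiplication-0597 (the other half,
"every finite group has an abelian subgroup of index `≤ d_max^8`", is a CFSG theorem of
Cossey–Halasi–Maróti–Nguyen 2015 not in the tree). [cite: Neumann2011, Cor. 4.2] -/
theorem card_rpow_le_index_rpow_of_packing_exponent (K : Subgroup G) [IsMulCommutative K]
    {S T U : Finset G} (h : TripleProductProperty S T U) {ε : ℝ} (hε : 0 ≤ ε)
    (hcard : (Fintype.card G : ℝ) ≤ ((S.card * T.card * U.card : ℕ) : ℝ) ^ ((2 + ε) / 3)) :
    (Fintype.card G : ℝ) ^ (1 - ε) ≤ (K.index : ℝ) ^ (4 + 2 * ε) := by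
  haveI : K.FiniteIndex := Subgroup.finiteIndex_of_finite
  have hVle := tpp_volume_le_index_sq_mul_card K h
  have hGpos : (0 : ℝ) < Fintype.card G := by exact_mod_cast Fintype.card_pos
  have hvpos : (0 : ℝ) < K.index := by
    exact_mod_cast Nat.pos_of_ne_zero Subgroup.FiniteIndex.index_ne_zero
  have h2 : (((S.card * T.card * U.card : ℕ)) : ℝ) ^ ((2 + ε) / 3) ≤
      ((K.index : ℝ) ^ (2 : ℝ) * Fintype.card G) ^ ((2 + ε) / 3) :=
    Real.rpow_le_rpow (by positivity) hVle (by linarith)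
  have h3 : ((K.index : ℝ) ^ (2 : ℝ) * Fintype.card G) ^ ((2 + ε) / 3) =
      (K.index : ℝ) ^ (2 * ((2 + ε) / 3)) * (Fintype.card G : ℝ) ^ ((2 + ε) / 3) := by
    rw [Real.mul_rpow (by positivity) hGpos.le, ← Real.rpow_mul hvpos.le]
  have hle : (Fintype.card G : ℝ) ≤
      (K.index : ℝ) ^ (2 * ((2 + ε) / 3)) * (Fintype.card G : ℝ) ^ ((2 + ε) / 3) :=
    hcard.trans (h2.trans_eq h3)
  have hlog := Real.log_le_log hGpos hle
  rw [Real.log_mul (Real.rpow_pos_of_pos hvpos _).ne' (Real.rpow_pos_of_pos hGpos _).ne',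
    Real.log_rpow hvpos, Real.log_rpow hGpos] at hlog
  rw [Real.rpow_def_of_pos hGpos, Real.rpow_def_of_pos hvpos, Real.exp_le_exp]
  nlinarith [hlog]

end AbelianIndex

/-! ### Perfect hosts with a large minimal degree: the STPP lane -/

section Perfect

variable {G : Type} [Group G] [Fintype G]

/-- A TPP triple of non-empty sets has volume `V ≤ |G|^{3/2}` (pairwise packing `|A||B|, |B||C|,
|C||A| ≤ |G|`, multiplied: `V² ≤ |G|³`). [cite: CohnUmans2003, Lemma 3.1 (proof)] -/
theorem tpp_volume_le_card_rpow_three_halves {S T U : Finset G} (h : TripleProductProperty S T U)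
    (hS : S.Nonempty) (hT : T.Nonempty) (hU : U.Nonempty) :
    (((S.card * T.card * U.card : ℕ)) : ℝ) ≤ (Fintype.card G : ℝ) ^ ((3 : ℝ) / 2) := by
  obtain ⟨h1, h2, h3⟩ := tpp_card_mul_card_le_three h hS hT hU
  have hsqN : (S.card * T.card * U.card) ^ 2 ≤ Fintype.card G ^ 3 := by
    calc (S.card * T.card * U.card) ^ 2 = (S.card * T.card) * (T.card * U.card) * (U.card * S.card) := by
          ring
      _ ≤ Fintype.card G * Fintype.card G * Fintype.card G :=
          Nat.mul_le_mul (Nat.mul_le_mul h1 h2) h3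
      _ = Fintype.card G ^ 3 := by ring
  have hsq : ((((S.card * T.card * U.card : ℕ)) : ℝ)) ^ (2 : ℝ) ≤ (Fintype.card G : ℝ) ^ (3 : ℝ) := by
    rw [show (2 : ℝ) = ((2 : ℕ) : ℝ) by norm_num, show (3 : ℝ) = ((3 : ℕ) : ℝ) by norm_num,
      Real.rpow_natCast, Real.rpow_natCast]
    exact_mod_cast hsqN
  have hV0 : (0 : ℝ) ≤ (((S.card * T.card * U.card : ℕ)) : ℝ) := Nat.cast_nonneg _
  have hG0 : (0 : ℝ) ≤ (Fintype.card G : ℝ) := Nat.cast_nonneg _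
  have key := Real.rpow_le_rpow (by positivity) hsq (by norm_num : (0 : ℝ) ≤ 1 / 2)
  rw [← Real.rpow_mul hV0, ← Real.rpow_mul hG0] at key
  norm_num at key
  exact_mod_cast key

/-- **STPP sums in perfect hosts, any exponent `w ≥ 2`.**  For a finite perfect group `G`
(`commutator G = ⊤`) and an STPP family of non-empty sets,
`Σᵢ Vᵢ^{w/3} ≤ |G|^{(w−2)/2} · max(√2|G|^{3/4}, 4^{1/3}|G|/n(G)^{1/3})`, `n(G)` the least character
degree `> 1`: the tree's STPP form of Blasiak–Cohn–Grochow–Pratt–Umans 2023 Cor. 3.3 bounds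
`Σᵢ Vᵢ^{2/3}`, and `Vᵢ^{(w−2)/3} ≤ |G|^{(w−2)/2}`. [cite: BlasiakCohnGrochowPrattUmans2023, Cor. 3.3] -/
theorem sum_rpow_le_of_perfect (hperf : commutator G = ⊤) {ι : Type*} [Fintype ι]
    {A B C : ι → Finset G} (hS : SimultaneousTPP A B C) (hA : ∀ i, (A i).Nonempty)
    (hB : ∀ i, (B i).Nonempty) (hC : ∀ i, (C i).Nonempty) {w : ℝ} (hw2 : 2 ≤ w) :
    ∑ i, (((A i).card * (B i).card * (C i).card : ℕ) : ℝ) ^ (w / 3) ≤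
      (Fintype.card G : ℝ) ^ ((w - 2) / 2) *
        max (Real.sqrt 2 * (Fintype.card G : ℝ) ^ (3 / 4 : ℝ))
          (4 ^ (1 / 3 : ℝ) * (Fintype.card G : ℝ) / (secondCharDegree G : ℝ) ^ (1 / 3 : ℝ)) := by
  have hcor := BCGPU2023_thm32_stpp.sum_rpow_two_thirds_le G hperf A B C hS hA hB hC
  have hG0 : (0 : ℝ) ≤ (Fintype.card G : ℝ) := Nat.cast_nonneg _
  have hterm : ∀ i, (((A i).card * (B i).card * (C i).card : ℕ) : ℝ) ^ (w / 3) ≤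
      (Fintype.card G : ℝ) ^ ((w - 2) / 2) *
        (((A i).card * (B i).card * (C i).card : ℕ) : ℝ) ^ (2 / 3 : ℝ) := by
    intro i
    set V : ℝ := (((A i).card * (B i).card * (C i).card : ℕ) : ℝ) with hV
    have hVpos : 0 < V := by
      rw [hV]
      exact_mod_cast Nat.mul_pos (Nat.mul_pos (hA i).card_pos (hB i).card_pos) (hC i).card_pos
    have hV32 : V ≤ (Fintype.card G : ℝ) ^ ((3 : ℝ) / 2) :=
      tpp_volume_le_card_rpow_three_halves (hS.1 i) (hA i) (hB i) (hC i)
    have hsplit : V ^ (w / 3) = V ^ ((w - 2) / 3) * V ^ (2 / 3 : ℝ) := by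
      rw [← Real.rpow_add hVpos]; ring_nf
    have hmono : V ^ ((w - 2) / 3) ≤ ((Fintype.card G : ℝ) ^ ((3 : ℝ) / 2)) ^ ((w - 2) / 3) :=
      Real.rpow_le_rpow hVpos.le hV32 (by linarith)
    rw [← Real.rpow_mul hG0, show (3 : ℝ) / 2 * ((w - 2) / 3) = (w - 2) / 2 by ring] at hmono
    rw [hsplit]
    exact mul_le_mul_of_nonneg_right hmono (Real.rpow_nonneg hVpos.le _)
  calc ∑ i, (((A i).card * (B i).card * (C i).card : ℕ) : ℝ) ^ (w / 3)
      ≤ ∑ i, (Fintype.card G : ℝ) ^ ((w - 2) / 2) *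
          (((A i).card * (B i).card * (C i).card : ℕ) : ℝ) ^ (2 / 3 : ℝ) :=
        Finset.sum_le_sum fun i _ => hterm i
    _ = (Fintype.card G : ℝ) ^ ((w - 2) / 2) *
          ∑ i, (((A i).card * (B i).card * (C i).card : ℕ) : ℝ) ^ (2 / 3 : ℝ) := by
        rw [Finset.mul_sum]
    _ ≤ _ := mul_le_mul_of_nonneg_left hcor (Real.rpow_nonneg hG0 _)

/-- **What a `d`-row certificate forces on a perfect host.**  If an STPP family of non-empty sets in a
finite perfect group `G` satisfies the certificate inequality `d^{w−2}|G| < Σᵢ Vᵢ^{w/3}` (`w ≥ 2`; the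
hypothesis of `STPPCriterion.omega_le_of_stpp_maxCharDegree`, any `d`), then
`d^{w−2}|G| < |G|^{(w−2)/2} · max(√2|G|^{3/4}, 4^{1/3}|G|/n(G)^{1/3})`.  Reading for `d = d_max`: either
`√2 (|G|^{1/2}/d_max)^{w−2} > |G|^{1/4}` or `4^{1/3} (|G|^{1/2}/d_max)^{w−2} > n(G)^{1/3}` — e.g. for the
Suzuki group `Sz(8)` (`|G| = 29120`, `d_max = 91`, `n(G) = 14`) both fail for every `w ≤ 2.66`, and for
`Sz(q)` (`|G|^{1/2}/d_max ≈ q^{1/2}`, `n(G)^{1/3} ≈ q^{1/2} 2^{−1/6}`) both fail for every fixed `w < 3` once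
`q` is large. [cite: BlasiakCohnGrochowPrattUmans2023, Cor. 3.3] -/
theorem perfect_host_certificate_bound (hperf : commutator G = ⊤) {ι : Type*} [Fintype ι]
    {A B C : ι → Finset G} (hS : SimultaneousTPP A B C) (hA : ∀ i, (A i).Nonempty)
    (hB : ∀ i, (B i).Nonempty) (hC : ∀ i, (C i).Nonempty) {d w : ℝ} (hw2 : 2 ≤ w)
    (hcert : d ^ (w - 2) * Fintype.card G <
      ∑ i, (((A i).card * (B i).card * (C i).card : ℕ) : ℝ) ^ (w / 3)) :
    d ^ (w - 2) * Fintype.card G <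
      (Fintype.card G : ℝ) ^ ((w - 2) / 2) *
        max (Real.sqrt 2 * (Fintype.card G : ℝ) ^ (3 / 4 : ℝ))
          (4 ^ (1 / 3 : ℝ) * (Fintype.card G : ℝ) / (secondCharDegree G : ℝ) ^ (1 / 3 : ℝ)) :=
  hcert.trans_le (sum_rpow_le_of_perfect hperf hS hA hB hC hw2)

end Perfect

end TPPLaneObstruction

end Summit.MatrixMultiplication.MatrixMultiplication.Theorems

end
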